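import Summits.HodgeConjecture.HodgeConjecture.Theorems.Ring2WeilCoverageCyclotomicTwistedLevel56
import Summits.HodgeConjecture.HodgeConjecture.Theorems.Ring2WeilCoverageCyclotomicTwistedLevel39Yes
import HarnessLib

/-!
# Weil-type family coverage — the index-2 levels `39` and `56` as single EQUIVALENCES: `ℂ^Φ/Φ(ℤ[ζ_M])` is
# principally polarisable iff both twisted sign counts are even; for `K`-balanced `Φ`, iff `n₊₋(Φ)` has b01.25's parity

research route conditional on HC_CM; not a corollary; Q11.4-sentence-2 already refuted in dim ≥ 3.

Ring 2, WEIL-TYPE FAMILY-COVERAGE CENSUS (`HOME/WEIL-FAMILY-COVERAGE.md` `## b01`, block b01.25 (A); owner ring2-b01),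
part 41 of the `Ring2WeilCoverage*` series — the capstone of parts 36/37 (NO direction) and 39/40 (YES direction):
for any `K` with `IsCyclotomicExtension {M} ℚ K`, `[IsCMField K]`, `ζ` a primitive `M`-th root of unity and ANY CM type
`Φ` with residue set `S_Φ`:

* **`principal_iff_thirtyNine` / `principal_iff_fiftySix`**: `ℂ^Φ/Φ(ℤ[ζ_M])` carries an `ι`-compatible principal
  polarisation (`∃ ζ′`, `ζ′^ρ = −ζ′`, `Im φ(ζ′) > 0` on `Φ`, `CMTypeLattice.IsOfType 1 ζ′ ⊤`) **iff**
  `|S_Φ ∩ C₊ ∩ N_odd|` and `|S_Φ ∩ C₋ ∩ N_odd|` are both even (`C₊ = {χ₁₃ = +1}` resp. `{χ₈ = +1}`; all sets displayed).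
* the census rows as equivalences for `K`-balanced `Φ` (`2|S_Φ ∩ N_K| = |S_Φ|`):
  **`principal_iff_odd_thirtyNine_sqrt_neg_three/_thirtyNine`** (`⟺ n₊₋(Φ)` odd),
  **`principal_iff_odd_fiftySix_sqrt_neg_one/_two`** (`⟺ n₊₋(Φ)` odd),
  **`principal_iff_even_fiftySix_sqrt_neg_seven/_fourteen`** (`⟺ n₊₋(Φ)` even) — census b01.25 (A) verbatim, every
  class, hypothesis-free, for the principal lattice.

HONEST FRAMING: statements about Shimura's divisors of principal type on `ℂ^Φ/Φ(ℤ[ζ_M])` (principal lattice class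
only); nothing about Hodge classes, `W_K`, general members or HC; `HC_CM` is used nowhere.  No `def`, no named fact, no
`sorry`.  References: [cite: Shimura1998, §14.3 Prop. 4–5, pp. 103–104]; census b01.25 (A) (seat-derived).
-/

noncomputable section

open Polynomial NumberField Complex Finset
open scoped Real nonZeroDivisors

namespace Summit.HodgeConjecture.Ring2WeilCoverage.CyclotomicTwistedLevelsIff

open Literature.AlgebraicGeometry.Motives (CMType)
open Literature.NumberTheory.ComplexMultiplication
open Summit.HodgeConjecture.Ring2WeilCoverage.CyclotomicTwistedLevel39
open Summit.HodgeConjecture.Ring2WeilCoverage.CyclotomicTwistedLevel56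
open Summit.HodgeConjecture.Ring2WeilCoverage.CyclotomicTwistedLevel39Yes
open Summit.HodgeConjecture.Ring2WeilCoverage.CyclotomicTwistedLevel56Yes

variable {K : Type} [Field K] [NumberField K] [IsCMField K] {ζ : K}

/-- `𝐞(t)` (`ZMod.toCircle`). -/
local notation3 (prettyPrint := false) "𝐞 " t:max => ((ZMod.toCircle t : Circle) : ℂ)

/-! ### Level `39` -/

section L39

variable [IsCyclotomicExtension {39} ℚ K]

/-- `N_odd` at `39` as a filter. -/
local notation3 (prettyPrint := false) "Nodd39" =>
  (Finset.univ.filter fun t : ZMod 39 => t.val.Coprime 39 ∧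
    Even (Finset.card (Finset.filter (fun s : ZMod 39 => s.val.Coprime 39 ∧ s.val < t.val) Finset.univ)))
/-- `C₊` at `39`. -/
local notation3 (prettyPrint := false) "Cp39" => ({1, 4, 10, 14, 16, 17, 22, 23, 25, 29, 35, 38} : Finset (ZMod 39))

open scoped Classical in
/-- **`ℂ^Φ/Φ(ℤ[ζ₃₉])` is principally polarisable iff both twisted sign counts are even** (`C₊ = {χ₁₃ = +1}`).
research route conditional on HC_CM; not a corollary; Q11.4-sentence-2 already refuted in dim ≥ 3. [cite: Shimura1998, §14.3 Prop. 5, p. 104] -/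
theorem principal_iff_thirtyNine (hζ : IsPrimitiveRoot ζ 39) (Φ : CMType K) :
    (∃ ζ' : K, IsCMField.complexConj K ζ' = -ζ' ∧ (∀ φ : Φ.1, 0 < (φ.1 ζ').im) ∧
        CMTypeLattice.IsOfType (1 : (FractionalIdeal (𝓞 K)⁰ K)ˣ) ζ' ⊤) ↔
      (Even (((Finset.univ.filter fun t : ZMod 39 => ∃ σ ∈ Φ.1, σ ζ = 𝐞 t) ∩ Nodd39).filter fun t => t ∈ Cp39).card ∧
        Even (((Finset.univ.filter fun t : ZMod 39 => ∃ σ ∈ Φ.1, σ ζ = 𝐞 t) ∩ Nodd39).filter fun t => t ∉ Cp39).card) := by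
  classical
  obtain ⟨hCp, hCm, -, -, -, -, -, -, -⟩ := classes_thirtyNine
  have hS := Literature.AlgebraicGeometry.ComplexMultiplication.CyclotomicCMType.isCMTypeSet_residueFilter hζ Φ
  have hcompl : ∀ t : ZMod 39, t.val.Coprime 39 →
      (t ∉ Cp39 ↔ t ∈ ({2, 5, 7, 8, 11, 19, 20, 28, 31, 32, 34, 37} : Finset (ZMod 39))) := fun t ht => by
    rw [hCp t ht, hCm t ht]; tauto
  -- the two filters as triple intersections with the displayed classes
  have e1 : (((Finset.univ.filter fun t : ZMod 39 => ∃ σ ∈ Φ.1, σ ζ = 𝐞 t) ∩ Nodd39).filter fun t => t ∈ Cp39) = (Finset.univ.filter fun t : ZMod 39 => ∃ σ ∈ Φ.1, σ ζ = 𝐞 t) ∩ Cp39 ∩ Nodd39 := by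
    ext t; simp only [mem_filter, mem_inter]; tauto
  have e2 : (((Finset.univ.filter fun t : ZMod 39 => ∃ σ ∈ Φ.1, σ ζ = 𝐞 t) ∩ Nodd39).filter fun t => t ∉ Cp39) =
      (Finset.univ.filter fun t : ZMod 39 => ∃ σ ∈ Φ.1, σ ζ = 𝐞 t) ∩ ({2, 5, 7, 8, 11, 19, 20, 28, 31, 32, 34, 37} : Finset (ZMod 39)) ∩ Nodd39 := by
    ext t
    simp only [mem_filter, mem_inter]
    constructor
    · rintro ⟨⟨htS, htN⟩, htC⟩
      exact ⟨⟨htS, (hcompl t (hS.1 t (Finset.mem_filter.mpr htS))).mp htC⟩, htN⟩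
    · rintro ⟨⟨htS, htC⟩, htN⟩
      exact ⟨⟨htS, htN⟩, (hcompl t (hS.1 t (Finset.mem_filter.mpr htS))).mpr htC⟩
  constructor
  · intro h
    by_contra hne
    rw [not_and_or, Nat.not_even_iff_odd, Nat.not_even_iff_odd] at hne
    rcases hne with h1 | h1
    · rw [e1, nodd_thirtyNine_eq] at h1
      exact not_exists_principal_thirtyNine_plus hζ Φ h1 h
    · rw [e2, nodd_thirtyNine_eq] at h1
      exact not_exists_principal_thirtyNine_minus hζ Φ h1 h
  · rintro ⟨h1, h2⟩
    exact exists_principal_thirtyNine_of_even_on hζ Φ h1 h2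

open scoped Classical in
/-- **Census row `(39, ℚ(√−3))` as an equivalence**: for `Φ` balanced for `N_K = {t ≡ 2 (mod 3)}`,
`ℂ^Φ/Φ(ℤ[ζ₃₉])` is principally polarisable **iff** `n₊₋(Φ) = |S_Φ ∩ {14,17,23,29,35,38}|` is ODD (b01.25 (A)).
research route conditional on HC_CM; not a corollary; Q11.4-sentence-2 already refuted in dim ≥ 3. [cite: Shimura1998, §14.3 Prop. 5, p. 104] -/
theorem principal_iff_odd_thirtyNine_sqrt_neg_three (hζ : IsPrimitiveRoot ζ 39) (Φ : CMType K)
    (hbal : 2 * ((Finset.univ.filter fun t : ZMod 39 => ∃ σ ∈ Φ.1, σ ζ = 𝐞 t) ∩ ({2, 5, 8, 11, 14, 17, 20, 23, 29, 32, 35, 38} : Finset (ZMod 39))).card = (Finset.univ.filter fun t : ZMod 39 => ∃ σ ∈ Φ.1, σ ζ = 𝐞 t).card) :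
    (∃ ζ' : K, IsCMField.complexConj K ζ' = -ζ' ∧ (∀ φ : Φ.1, 0 < (φ.1 ζ').im) ∧
        CMTypeLattice.IsOfType (1 : (FractionalIdeal (𝓞 K)⁰ K)ˣ) ζ' ⊤) ↔
      Odd (((Finset.univ.filter fun t : ZMod 39 => ∃ σ ∈ Φ.1, σ ζ = 𝐞 t) ∩ ({14, 17, 23, 29, 35, 38} : Finset (ZMod 39))).card) := by
  constructor
  · intro h
    by_contra hne
    exact not_exists_principal_thirtyNine_of_even hζ Φ (Nat.not_odd_iff_even.mp hne) h
  · exact exists_principal_thirtyNine_sqrt_neg_three hζ Φ hbal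

open scoped Classical in
/-- **Census row `(39, ℚ(√−39))` as an equivalence**: for `Φ` balanced for `N_K = {7,14,17,19,23,28,29,31,34,35,37,38}`,
principally polarisable **iff** `n₊₋(Φ)` is ODD.
research route conditional on HC_CM; not a corollary; Q11.4-sentence-2 already refuted in dim ≥ 3. [cite: Shimura1998, §14.3 Prop. 5, p. 104] -/
theorem principal_iff_odd_thirtyNine_sqrt_neg_thirtyNine (hζ : IsPrimitiveRoot ζ 39) (Φ : CMType K)
    (hbal : 2 * ((Finset.univ.filter fun t : ZMod 39 => ∃ σ ∈ Φ.1, σ ζ = 𝐞 t) ∩ ({7, 14, 17, 19, 23, 28, 29, 31, 34, 35, 37, 38} : Finset (ZMod 39))).card =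
      (Finset.univ.filter fun t : ZMod 39 => ∃ σ ∈ Φ.1, σ ζ = 𝐞 t).card) :
    (∃ ζ' : K, IsCMField.complexConj K ζ' = -ζ' ∧ (∀ φ : Φ.1, 0 < (φ.1 ζ').im) ∧
        CMTypeLattice.IsOfType (1 : (FractionalIdeal (𝓞 K)⁰ K)ˣ) ζ' ⊤) ↔
      Odd (((Finset.univ.filter fun t : ZMod 39 => ∃ σ ∈ Φ.1, σ ζ = 𝐞 t) ∩ ({14, 17, 23, 29, 35, 38} : Finset (ZMod 39))).card) := by
  constructor
  · intro h
    by_contra hne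
    exact not_exists_principal_thirtyNine_of_even hζ Φ (Nat.not_odd_iff_even.mp hne) h
  · exact exists_principal_thirtyNine_sqrt_neg_thirtyNine hζ Φ hbal

end L39

/-! ### Level `56` -/

section L56

variable [IsCyclotomicExtension {56} ℚ K]

/-- `N_odd` at `56` as a filter. -/
local notation3 (prettyPrint := false) "Nodd56" =>
  (Finset.univ.filter fun t : ZMod 56 => t.val.Coprime 56 ∧
    Even (Finset.card (Finset.filter (fun s : ZMod 56 => s.val.Coprime 56 ∧ s.val < t.val) Finset.univ)))
/-- `C₊` at `56`. -/
local notation3 (prettyPrint := false) "Cp56" => ({1, 9, 15, 17, 23, 25, 31, 33, 39, 41, 47, 55} : Finset (ZMod 56))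

open scoped Classical in
/-- **`ℂ^Φ/Φ(ℤ[ζ₅₆])` is principally polarisable iff both twisted sign counts are even** (`C₊ = {χ₈ = +1}`).
research route conditional on HC_CM; not a corollary; Q11.4-sentence-2 already refuted in dim ≥ 3. [cite: Shimura1998, §14.3 Prop. 5, p. 104] -/
theorem principal_iff_fiftySix (hζ : IsPrimitiveRoot ζ 56) (Φ : CMType K) :
    (∃ ζ' : K, IsCMField.complexConj K ζ' = -ζ' ∧ (∀ φ : Φ.1, 0 < (φ.1 ζ').im) ∧
        CMTypeLattice.IsOfType (1 : (FractionalIdeal (𝓞 K)⁰ K)ˣ) ζ' ⊤) ↔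
      (Even (((Finset.univ.filter fun t : ZMod 56 => ∃ σ ∈ Φ.1, σ ζ = 𝐞 t) ∩ Nodd56).filter fun t => t ∈ Cp56).card ∧
        Even (((Finset.univ.filter fun t : ZMod 56 => ∃ σ ∈ Φ.1, σ ζ = 𝐞 t) ∩ Nodd56).filter fun t => t ∉ Cp56).card) := by
  classical
  obtain ⟨hcompl, -, -, -, -, -, -, -⟩ := classFacts_fiftySix
  have hS := Literature.AlgebraicGeometry.ComplexMultiplication.CyclotomicCMType.isCMTypeSet_residueFilter hζ Φ
  have e1 : (((Finset.univ.filter fun t : ZMod 56 => ∃ σ ∈ Φ.1, σ ζ = 𝐞 t) ∩ Nodd56).filter fun t => t ∈ Cp56) = (Finset.univ.filter fun t : ZMod 56 => ∃ σ ∈ Φ.1, σ ζ = 𝐞 t) ∩ Cp56 ∩ Nodd56 := by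
    ext t; simp only [mem_filter, mem_inter]; tauto
  have e2 : (((Finset.univ.filter fun t : ZMod 56 => ∃ σ ∈ Φ.1, σ ζ = 𝐞 t) ∩ Nodd56).filter fun t => t ∉ Cp56) =
      (Finset.univ.filter fun t : ZMod 56 => ∃ σ ∈ Φ.1, σ ζ = 𝐞 t) ∩ ({3, 5, 11, 13, 19, 27, 29, 37, 43, 45, 51, 53} : Finset (ZMod 56)) ∩ Nodd56 := by
    ext t
    simp only [mem_filter, mem_inter]
    constructor
    · rintro ⟨⟨htS, htN⟩, htC⟩
      exact ⟨⟨htS, (hcompl t (hS.1 t (Finset.mem_filter.mpr htS))).mp htC⟩, htN⟩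
    · rintro ⟨⟨htS, htC⟩, htN⟩
      exact ⟨⟨htS, htN⟩, (hcompl t (hS.1 t (Finset.mem_filter.mpr htS))).mpr htC⟩
  constructor
  · intro h
    by_contra hne
    rw [not_and_or, Nat.not_even_iff_odd, Nat.not_even_iff_odd] at hne
    rcases hne with h1 | h1
    · rw [e1, nodd_fiftySix_eq] at h1
      exact not_exists_principal_fiftySix_plus hζ Φ h1 h
    · rw [e2, nodd_fiftySix_eq] at h1
      exact not_exists_principal_fiftySix_minus hζ Φ h1 h
  · rintro ⟨h1, h2⟩
    exact exists_principal_fiftySix_of_even_on hζ Φ h1 h2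

open scoped Classical in
/-- **Census row `(56, ℚ(i))` as an equivalence**: for `Φ` balanced for `N_K = {t ≡ 3 (mod 4)}`, principally polarisable
**iff** `n₊₋(Φ) = |S_Φ ∩ {15,23,31,39,47,55}|` is ODD.
research route conditional on HC_CM; not a corollary; Q11.4-sentence-2 already refuted in dim ≥ 3. [cite: Shimura1998, §14.3 Prop. 5, p. 104] -/
theorem principal_iff_odd_fiftySix_sqrt_neg_one (hζ : IsPrimitiveRoot ζ 56) (Φ : CMType K)
    (hbal : 2 * ((Finset.univ.filter fun t : ZMod 56 => ∃ σ ∈ Φ.1, σ ζ = 𝐞 t) ∩ ({3, 11, 15, 19, 23, 27, 31, 39, 43, 47, 51, 55} : Finset (ZMod 56))).card =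
      (Finset.univ.filter fun t : ZMod 56 => ∃ σ ∈ Φ.1, σ ζ = 𝐞 t).card) :
    (∃ ζ' : K, IsCMField.complexConj K ζ' = -ζ' ∧ (∀ φ : Φ.1, 0 < (φ.1 ζ').im) ∧
        CMTypeLattice.IsOfType (1 : (FractionalIdeal (𝓞 K)⁰ K)ˣ) ζ' ⊤) ↔
      Odd (((Finset.univ.filter fun t : ZMod 56 => ∃ σ ∈ Φ.1, σ ζ = 𝐞 t) ∩ ({15, 23, 31, 39, 47, 55} : Finset (ZMod 56))).card) := by
  constructor
  · intro h
    by_contra hne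
    exact not_exists_principal_fiftySix_of_even hζ Φ (Nat.not_odd_iff_even.mp hne) h
  · exact exists_principal_fiftySix_sqrt_neg_one hζ Φ hbal

open scoped Classical in
/-- **Census row `(56, ℚ(√−2))` as an equivalence**: balanced for `N_K = {5,13,15,23,29,31,37,39,45,47,53,55}`:
principally polarisable **iff** `n₊₋(Φ)` is ODD.
research route conditional on HC_CM; not a corollary; Q11.4-sentence-2 already refuted in dim ≥ 3. [cite: Shimura1998, §14.3 Prop. 5, p. 104] -/
theorem principal_iff_odd_fiftySix_sqrt_neg_two (hζ : IsPrimitiveRoot ζ 56) (Φ : CMType K)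
    (hbal : 2 * ((Finset.univ.filter fun t : ZMod 56 => ∃ σ ∈ Φ.1, σ ζ = 𝐞 t) ∩ ({5, 13, 15, 23, 29, 31, 37, 39, 45, 47, 53, 55} : Finset (ZMod 56))).card =
      (Finset.univ.filter fun t : ZMod 56 => ∃ σ ∈ Φ.1, σ ζ = 𝐞 t).card) :
    (∃ ζ' : K, IsCMField.complexConj K ζ' = -ζ' ∧ (∀ φ : Φ.1, 0 < (φ.1 ζ').im) ∧
        CMTypeLattice.IsOfType (1 : (FractionalIdeal (𝓞 K)⁰ K)ˣ) ζ' ⊤) ↔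
      Odd (((Finset.univ.filter fun t : ZMod 56 => ∃ σ ∈ Φ.1, σ ζ = 𝐞 t) ∩ ({15, 23, 31, 39, 47, 55} : Finset (ZMod 56))).card) := by
  constructor
  · intro h
    by_contra hne
    exact not_exists_principal_fiftySix_of_even hζ Φ (Nat.not_odd_iff_even.mp hne) h
  · exact exists_principal_fiftySix_sqrt_neg_two hζ Φ hbal

open scoped Classical in
/-- **Census row `(56, ℚ(√−7))` as an equivalence**: balanced for `N_K = {3,5,13,17,19,27,31,33,41,45,47,55}`:
principally polarisable **iff** `n₊₋(Φ) = |S_Φ ∩ {17,31,33,41,47,55}|` is EVEN.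
research route conditional on HC_CM; not a corollary; Q11.4-sentence-2 already refuted in dim ≥ 3. [cite: Shimura1998, §14.3 Prop. 5, p. 104] -/
theorem principal_iff_even_fiftySix_sqrt_neg_seven (hζ : IsPrimitiveRoot ζ 56) (Φ : CMType K)
    (hbal : 2 * ((Finset.univ.filter fun t : ZMod 56 => ∃ σ ∈ Φ.1, σ ζ = 𝐞 t) ∩ ({3, 5, 13, 17, 19, 27, 31, 33, 41, 45, 47, 55} : Finset (ZMod 56))).card =
      (Finset.univ.filter fun t : ZMod 56 => ∃ σ ∈ Φ.1, σ ζ = 𝐞 t).card) :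
    (∃ ζ' : K, IsCMField.complexConj K ζ' = -ζ' ∧ (∀ φ : Φ.1, 0 < (φ.1 ζ').im) ∧
        CMTypeLattice.IsOfType (1 : (FractionalIdeal (𝓞 K)⁰ K)ˣ) ζ' ⊤) ↔
      Even (((Finset.univ.filter fun t : ZMod 56 => ∃ σ ∈ Φ.1, σ ζ = 𝐞 t) ∩ ({17, 31, 33, 41, 47, 55} : Finset (ZMod 56))).card) := by
  constructor
  · intro h
    by_contra hne
    exact not_exists_principal_fiftySix_of_odd hζ Φ (Nat.not_even_iff_odd.mp hne) h
  · exact exists_principal_fiftySix_sqrt_neg_seven hζ Φ hbal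

open scoped Classical in
/-- **Census row `(56, ℚ(√−14))` as an equivalence**: balanced for `N_K = {11,17,29,31,33,37,41,43,47,51,53,55}`:
principally polarisable **iff** `n₊₋(Φ)` is EVEN.
research route conditional on HC_CM; not a corollary; Q11.4-sentence-2 already refuted in dim ≥ 3. [cite: Shimura1998, §14.3 Prop. 5, p. 104] -/
theorem principal_iff_even_fiftySix_sqrt_neg_fourteen (hζ : IsPrimitiveRoot ζ 56) (Φ : CMType K)
    (hbal : 2 * ((Finset.univ.filter fun t : ZMod 56 => ∃ σ ∈ Φ.1, σ ζ = 𝐞 t) ∩ ({11, 17, 29, 31, 33, 37, 41, 43, 47, 51, 53, 55} : Finset (ZMod 56))).card =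
      (Finset.univ.filter fun t : ZMod 56 => ∃ σ ∈ Φ.1, σ ζ = 𝐞 t).card) :
    (∃ ζ' : K, IsCMField.complexConj K ζ' = -ζ' ∧ (∀ φ : Φ.1, 0 < (φ.1 ζ').im) ∧
        CMTypeLattice.IsOfType (1 : (FractionalIdeal (𝓞 K)⁰ K)ˣ) ζ' ⊤) ↔
      Even (((Finset.univ.filter fun t : ZMod 56 => ∃ σ ∈ Φ.1, σ ζ = 𝐞 t) ∩ ({17, 31, 33, 41, 47, 55} : Finset (ZMod 56))).card) := by
  constructor
  · intro h
    by_contra hne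
    exact not_exists_principal_fiftySix_of_odd hζ Φ (Nat.not_even_iff_odd.mp hne) h
  · exact exists_principal_fiftySix_sqrt_neg_fourteen hζ Φ hbal

end L56

end Summit.HodgeConjecture.Ring2WeilCoverage.CyclotomicTwistedLevelsIff

end
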